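/-
Copyright (c) 2026 the pub-hodgecm-mathlib formalisation cell (harness21).  Prover seat hodgecm-mathlib-LH4-p01 (g0): line LH4, SHALIKA pay-down (dealer LH4-plan (g2)
04:17:40Z, organ SPAN-c «U3-STRATA», matrix half); 2026-09-02.
-/
import Literature.NumberTheory.Automorphic.UnitaryThreeRegularUnipotentClass               -- ★ `exists_conj_eq_of_regular_unipotent`; brings ★ `UnitaryThreeUnipotentConjugacy` (corner normal form) + ★ `UnitaryThreeSingularUnipotentClasses` (the `B₀` invariant)
import Mathlib.RingTheory.Henselian
import Mathlib.Topology.Algebra.Valued.ValuationTopology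
import Mathlib.Topology.Instances.Matrix
import HarnessLib

/-!
# The transvection classes of `U(σ, J₀)` over a valued field are OPEN IN THEIR STRATUM (odd residue characteristic): the norm class of the invariant
# `B₀(x, (g − 1)x) ∈ t·N(K)` is locally constant (Rogawski 1990 §3.9; Serre, Local Fields V §3)

Topic `NumberTheory/Automorphic`; namespace `Literature.NumberTheory.Automorphic.UnitaryGroup`.  THEOREMS ONLY (no definition, no instance, no notation, no named fact, no `sorry`);
kernel lane `--supports stmt-HodgeConjecture-24833`.  Cell `pub/hodgecm-mathlib` (D-0151), crux H413 = `stmt-HodgeConjecture-24833`; line LH4, SHALIKA pay-down of the print row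
`stub_N6nsShalika` (LH4-plan (g2) memo `LH4-SHALIKA-LINE.v1` c57a22003299b6e9 §3), organ SPAN-c «U3-STRATA» — the FIELD-GENERAL half; the CM carrier
`(cmDatum L 3 Φ₃).Local v` is served by the sequel `Rogawski1990/UnitaryThreeUnipotentStrataCM`.

SETTING: a field `K` with `Valued K ℤᵐ⁰`, `σ : K →+* K` an isometric involution (`hσ`, `hvσ`), `|2| = 1`, and — for the Hensel step — `HenselianLocalRing 𝒪[K]` (true for every
`w.adicCompletion L`, ★ `adicCompletionIntegers.henselianLocalRing`); `U(σ, J₀) = unitaryGroupOfForm σ ((StdForm.antidiagonal 3).over K) ≤ GL₃(K)`.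

THE MATHEMATICS ([Rogawski1990, §3.9]): a singular unipotent `g ∈ U(σ, J₀)` (`(g − 1)² = 0`, `g ≠ 1`) is conjugate to some `n(t) = 1 + t·E₀₂`, `t ∈ E⁰ ∖ 0` (★
`exists_conj_coe_eq_cornerUnipotent_of_sq_eq_zero`), `[n(t)] = [n(t′)] ⟺ t′ ∈ t·N(K^×)` (★ `exists_conj_eq_iff_exists_norm_mul`), and the value set `{B₀(x, (g − 1)x) : x} = t·N(K)`
is a class invariant (★ `range_B₀_conj_sub_one_mulVec`).  NEW here: the class is cut out of the stratum `{(g−1)² = 0, g ≠ 1}` by the OPEN set `V = {g | ∃ x, |B₀(x, (g−1)x) − t| < |t|}` —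
because a `σ`-fixed principal unit `a` (`|a − 1| < 1`) is a NORM at odd residue characteristic: Hensel lifts the residual root `1` of `X² − a` to `b` with `b² = a`, `|b − 1| < 1`,
and then `σ b = b` (the alternative `σ b = −b` would give `|σ b − 1| = |b + 1| = |2| = 1`), so `a = b·σ b`.

* §1 `exists_eq_mul_map_of_map_eq_self_of_v_sub_one_lt_one` (fixed principal units are norms), `continuous_B₀_sub_one_mulVec`, `isOpen_setOf_exists_v_B₀_sub_lt`,
  **`exists_isOpen_transvection_class`** (an open `V ⊇` the class of `g₀` with `V ∩ {transvections of U(σ, J₀)} = ` that class), `isClosed_setOf_coe_sub_one_pow_eq_zero`.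

HONEST LABEL: HC_CM is proved only modulo the 7 printed citations (2 remaining named inputs: hLiu418 = stmt-HodgeConjecture-24832, h413 = stmt-HodgeConjecture-24833) until
rung 0 closes; in-house linear algebra ∕ point-set topology over a valued field, count-neutral.

## References
* [Rogawski1990] J. D. Rogawski, *Automorphic Representations of Unitary Groups in Three Variables*, Ann. of Math. Stud. 123 (1990), §3.9 p. 32, Prop. 3.9.1.
* [Serre1979] J.-P. Serre, *Local Fields*, GTM 67 (1979), Ch. V §3 (norm groups of local quadratic extensions; principal units), Ch. II §4 (Hensel's lemma).
* [BernsteinZelevinsky1976] I. N. Bernstein, A. V. Zelevinsky, *Representations of the group GL(n, F) where F is a non-archimedean local field*, Russian Math. Surveys 31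
  (1976), §1.5 (l-spaces, locally closed strata).
* [PlatonovRapinchuk1994] V. Platonov, A. Rapinchuk, *Algebraic Groups and Number Theory* (1994), §3.1 (the topology of `G(K_v)`).
-/

set_option autoImplicit false

noncomputable section

open scoped Valued WithZero Matrix MatrixGroups
open Topology Set Matrix Polynomial

namespace Literature.NumberTheory.Automorphic.UnitaryGroup

open Literature.NumberTheory.Automorphic Literature.NumberTheory.Automorphic.HermitianLattice

/-! ## §1 `U(σ, J₀)(K)` over a valued field `K` with Henselian integers, `σ` an isometric involution, `|2| = 1` -/

section MatrixSide

variable {K : Type*} [Field K] [Valued K ℤᵐ⁰] (σ : K →+* K)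

/-- **A `σ`-fixed principal unit is a norm** (odd residue characteristic): if `σ a = a` and `|a − 1| < 1` then `a = z·σz` for some `z ≠ 0` — Hensel lifts the root `1` of
`X² − a (mod 𝔪)` to `b` with `b² = a`, `|b − 1| < 1`, and `σ b = b` (else `σ b = −b` and `|σ b − 1| = |b + 1| = |2| = 1`). [cite: Serre1979, Ch. V §3; Ch. II §4] [cite: Rogawski1990, §3.9 p. 32] -/
theorem exists_eq_mul_map_of_map_eq_self_of_v_sub_one_lt_one [HenselianLocalRing 𝒪[K]] (hvσ : ∀ a, Valued.v (σ a) = Valued.v a)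
    (h2 : Valued.v (2 : K) = 1) {a : K} (hfix : σ a = a) (ha : Valued.v (a - 1) < 1) : ∃ z : K, z ≠ 0 ∧ a = z * σ z := by
  have hint : (Valued.v (R := K)).Integers 𝒪[K] := Valuation.integer.integers _
  have ha1 : Valued.v a = 1 := by
    have h := Valuation.map_one_add_of_lt Valued.v ha
    rwa [add_sub_cancel] at h
  have haO : a ∈ 𝒪[K] := by rw [Valuation.mem_integer_iff, ha1]
  set aO : 𝒪[K] := ⟨a, haO⟩ with haO_def
  have h2O : IsUnit (2 : 𝒪[K]) := hint.isUnit_iff_valuation_eq_one.2 (by rw [map_ofNat]; exact h2)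
  -- Hensel for `X² − a` at `1`
  have hroot : (X ^ 2 - C aO).eval 1 ∈ IsLocalRing.maximalIdeal 𝒪[K] := by
    rw [eval_sub, eval_pow, eval_X, eval_C, one_pow, IsLocalRing.mem_maximalIdeal, mem_nonunits_iff, hint.isUnit_iff_valuation_eq_one]
    intro h
    have h' : Valued.v ((1 : K) - a) = 1 := h
    rw [← Valuation.map_neg, neg_sub] at h'
    exact (lt_irrefl _) (h' ▸ ha)
  have hder : IsUnit ((derivative (X ^ 2 - C aO)).eval 1) := by
    have : (derivative (X ^ 2 - C aO)).eval (1 : 𝒪[K]) = 2 := by simp; norm_num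
    rw [this]; exact h2O
  obtain ⟨b, hb, hb1⟩ := HenselianLocalRing.is_henselian (X ^ 2 - C aO) (monic_X_pow_sub_C aO two_ne_zero) 1 hroot hder
  have hb2 : ((b : K)) ^ 2 = a := by
    have h := hb
    rw [IsRoot.def, eval_sub, eval_pow, eval_X, eval_C, sub_eq_zero] at h
    exact congrArg Subtype.val h
  have hb1' : Valued.v ((b : K) - 1) < 1 := by
    rw [IsLocalRing.mem_maximalIdeal, mem_nonunits_iff, hint.isUnit_iff_valuation_eq_one] at hb1
    exact lt_of_le_of_ne (b - 1).2 hb1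
  -- `σ b = b`
  have hσb1 : Valued.v (σ (b : K) - 1) < 1 := by rw [← map_one σ, ← map_sub, hvσ]; exact hb1'
  have hsq : (σ (b : K) - b) * (σ (b : K) + b) = 0 := by
    have h : σ (b : K) ^ 2 = (b : K) ^ 2 := by rw [← map_pow, hb2, hfix]
    linear_combination h
  have hσb : σ (b : K) = b := by
    rcases mul_eq_zero.1 hsq with h | h
    · exact sub_eq_zero.1 h
    · exfalso
      have hplus : Valued.v ((b : K) + 1) = 1 := by
        have := Valuation.map_add_eq_of_lt_left Valued.v (x := (2 : K)) (y := (b : K) - 1) (by rw [h2]; exact hb1')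
        rw [h2] at this
        rw [← this]; congr 1; ring
      have : σ (b : K) - 1 = -((b : K) + 1) := by linear_combination h
      rw [this, Valuation.map_neg, hplus] at hσb1
      exact lt_irrefl _ hσb1
  refine ⟨b, ?_, ?_⟩
  · intro hb0
    rw [hb0, zero_pow two_ne_zero] at hb2
    rw [← hb2, map_zero] at ha1
    exact zero_ne_one ha1
  · rw [hσb, ← pow_two, hb2]

/-- The form value `B₀(x, (g − 1)x)` depends continuously on `g ∈ GL₃(K)` (`x` fixed). [cite: PlatonovRapinchuk1994, §3.1] -/
theorem continuous_B₀_sub_one_mulVec (x : Fin 3 → K) :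
    Continuous fun g : GL (Fin 3) K => B₀ σ 3 x (((g : Matrix (Fin 3) (Fin 3) K) - 1) *ᵥ x) := by
  have hy : Continuous fun g : GL (Fin 3) K => ((g : Matrix (Fin 3) (Fin 3) K) - 1) *ᵥ x :=
    (Units.continuous_val.sub continuous_const).matrix_mulVec continuous_const
  have h3 : ∀ i : Fin 3, Continuous fun g : GL (Fin 3) K => (((g : Matrix (Fin 3) (Fin 3) K) - 1) *ᵥ x) i :=
    fun i => (continuous_apply i).comp hy
  simp only [B₀_three_apply]
  exact ((continuous_const.mul (h3 2)).add (continuous_const.mul (h3 1))).add (continuous_const.mul (h3 0))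

/-- The set of `g ∈ GL₃(K)` for which SOME value `B₀(x, (g − 1)x)` lies in the ball `t·(1 + 𝔪)` is open. [cite: PlatonovRapinchuk1994, §3.1] -/
theorem isOpen_setOf_exists_v_B₀_sub_lt (t : K) :
    IsOpen {g : GL (Fin 3) K | ∃ x : Fin 3 → K, Valued.v (B₀ σ 3 x (((g : Matrix (Fin 3) (Fin 3) K) - 1) *ᵥ x) - t) < Valued.v t} := by
  have hball : IsOpen {c : K | Valued.v (c - t) < Valued.v t} := by
    have h1 : IsOpen {y : K | Valued.v y < Valued.v t} := by
      simpa only [Valuation.restrict_lt_iff] using Valued.isOpen_ball K (Valued.v.restrict t)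
    exact h1.preimage (continuous_id.sub continuous_const)
  have : {g : GL (Fin 3) K | ∃ x : Fin 3 → K, Valued.v (B₀ σ 3 x (((g : Matrix (Fin 3) (Fin 3) K) - 1) *ᵥ x) - t) < Valued.v t} =
      ⋃ x : Fin 3 → K, (fun g : GL (Fin 3) K => B₀ σ 3 x (((g : Matrix (Fin 3) (Fin 3) K) - 1) *ᵥ x)) ⁻¹' {c : K | Valued.v (c - t) < Valued.v t} := by
    ext g; simp
  rw [this]
  exact isOpen_iUnion fun x => hball.preimage (continuous_B₀_sub_one_mulVec σ x)

/-- **THE TRANSVECTION CLASS IS CUT OUT BY AN OPEN SET INSIDE ITS STRATUM** ([Rogawski1990] §3.9: the singular unipotent classes of `U(σ, J₀)` are the `[n(t)]`,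
`t ∈ E⁰ ∖ 0` modulo `N E^×`; at odd residue characteristic the norm class of the invariant `B₀(x, (g − 1)x) ∈ t·N(K)` is LOCALLY CONSTANT because a `σ`-fixed principal unit
is a norm): for `g₀ ∈ U(σ, J₀)` with `(g₀ − 1)² = 0`, `g₀ ≠ 1`, there is an OPEN `V ⊆ GL₃(K)` containing the `U(σ, J₀)`-class of `g₀` such that every `g ∈ U(σ, J₀) ∩ V` with
`(g − 1)² = 0`, `g ≠ 1` is `U(σ, J₀)`-conjugate to `g₀`. [cite: Rogawski1990, §3.9 p. 32, Prop. 3.9.1] [cite: BernsteinZelevinsky1976, §1.5] -/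
theorem exists_isOpen_transvection_class [HenselianLocalRing 𝒪[K]] (hσ : ∀ z : K, σ (σ z) = z) (hvσ : ∀ a, Valued.v (σ a) = Valued.v a) (h2 : Valued.v (2 : K) = 1)
    {g₀ : GL (Fin 3) K} (hg₀ : g₀ ∈ unitaryGroupOfForm σ ((StdForm.antidiagonal 3).over K))
    (hsq₀ : ((g₀ : Matrix (Fin 3) (Fin 3) K) - 1) * ((g₀ : Matrix (Fin 3) (Fin 3) K) - 1) = 0) (hne₀ : g₀ ≠ 1) :
    ∃ V : Set (GL (Fin 3) K), IsOpen V ∧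
      (∀ k ∈ unitaryGroupOfForm σ ((StdForm.antidiagonal 3).over K), k * g₀ * k⁻¹ ∈ V) ∧
      ∀ g ∈ unitaryGroupOfForm σ ((StdForm.antidiagonal 3).over K),
        ((g : Matrix (Fin 3) (Fin 3) K) - 1) * ((g : Matrix (Fin 3) (Fin 3) K) - 1) = 0 → g ≠ 1 → g ∈ V →
        ∃ k ∈ unitaryGroupOfForm σ ((StdForm.antidiagonal 3).over K), k * g₀ * k⁻¹ = g := by
  -- normal form `k₀ g₀ k₀⁻¹ = n(t)`, `t ≠ 0`
  obtain ⟨k₀, hk₀, t, hσt, hu⟩ := exists_conj_coe_eq_cornerUnipotent_of_sq_eq_zero σ hσ hg₀ hsq₀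
  have ht : t ≠ 0 := by
    intro ht0
    apply hne₀
    have h1 : k₀ * g₀ * k₀⁻¹ = 1 := Units.ext (by rw [hu, ht0, Units.val_one]; ext i j; fin_cases i <;> fin_cases j <;> rfl)
    calc g₀ = k₀⁻¹ * (k₀ * g₀ * k₀⁻¹) * k₀ := by group
      _ = 1 := by rw [h1]; group
  refine ⟨{g : GL (Fin 3) K | ∃ x : Fin 3 → K, Valued.v (B₀ σ 3 x (((g : Matrix (Fin 3) (Fin 3) K) - 1) *ᵥ x) - t) < Valued.v t},
    isOpen_setOf_exists_v_B₀_sub_lt σ t, ?_, ?_⟩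
  · -- the class of `g₀` lies in `V`: `k g₀ k⁻¹ = k₁ n(t) k₁⁻¹` takes the value `t` at `x = k₁ e₂`
    intro k hk
    have hk₁ : k * k₀⁻¹ ∈ unitaryGroupOfForm σ ((StdForm.antidiagonal 3).over K) := mul_mem hk (inv_mem hk₀)
    have hconj : k * g₀ * k⁻¹ = (k * k₀⁻¹) * (k₀ * g₀ * k₀⁻¹) * (k * k₀⁻¹)⁻¹ := by group
    have hmem : t * (σ 1 * 1) ∈ Set.range (fun x : Fin 3 → K => B₀ σ 3 x (((((k * k₀⁻¹) * (k₀ * g₀ * k₀⁻¹) * (k * k₀⁻¹)⁻¹ : GL (Fin 3) K) : Matrix (Fin 3) (Fin 3) K) - 1) *ᵥ x)) := by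
      rw [range_B₀_conj_sub_one_mulVec σ hu hk₁]; exact ⟨1, rfl⟩
    obtain ⟨x, hx⟩ := hmem
    beta_reduce at hx
    refine ⟨x, ?_⟩
    rw [hconj]
    have hx' : B₀ σ 3 x (((((k * k₀⁻¹) * (k₀ * g₀ * k₀⁻¹) * (k * k₀⁻¹)⁻¹ : GL (Fin 3) K) : Matrix (Fin 3) (Fin 3) K) - 1) *ᵥ x) = t := by
      rw [hx, map_one, one_mul, mul_one]
    rw [hx', sub_self, map_zero]
    exact (Valuation.pos_iff _).2 ht
  · -- a transvection in `V` is conjugate to `g₀`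
    intro g hg hsq hne ⟨x, hx⟩
    obtain ⟨k₂, hk₂, t', hσt', hu'⟩ := exists_conj_coe_eq_cornerUnipotent_of_sq_eq_zero σ hσ hg hsq
    have ht' : t' ≠ 0 := by
      intro ht0
      apply hne
      have h1 : k₂ * g * k₂⁻¹ = 1 := Units.ext (by rw [hu', ht0, Units.val_one]; ext i j; fin_cases i <;> fin_cases j <;> rfl)
      calc g = k₂⁻¹ * (k₂ * g * k₂⁻¹) * k₂ := by group
        _ = 1 := by rw [h1]; group
    -- the value at `x` reads `t'·N(a)`
    have hgconj : g = k₂⁻¹ * (k₂ * g * k₂⁻¹) * (k₂⁻¹)⁻¹ := by group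
    set a : K := (((k₂⁻¹)⁻¹ : GL (Fin 3) K) : Matrix (Fin 3) (Fin 3) K).mulVec x 2 with ha_def
    have hval : B₀ σ 3 x (((g : Matrix (Fin 3) (Fin 3) K) - 1) *ᵥ x) = t' * (σ a * a) := by
      conv_lhs => rw [hgconj]
      exact B₀_apply_conj_sub_one_mulVec σ hu' (inv_mem hk₂) x
    rw [hval] at hx
    have ha0 : a ≠ 0 := by
      intro h0
      rw [h0, mul_zero, mul_zero, zero_sub, Valuation.map_neg] at hx
      exact lt_irrefl _ hx
    -- the quotient `t⁻¹ t' N(a)` is a `σ`-fixed principal unit, hence a norm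
    have hσa' : σ (t⁻¹ * (t' * (σ a * a))) = t⁻¹ * (t' * (σ a * a)) := by
      have hσt1 : σ t = -t := by linear_combination hσt
      have hσt2 : σ t' = -t' := by linear_combination hσt'
      rw [map_mul, map_mul, map_mul, map_inv₀, hσt1, hσt2, hσ, inv_neg]; ring
    have hlt : Valued.v (t⁻¹ * (t' * (σ a * a)) - 1) < 1 := by
      have h : t⁻¹ * (t' * (σ a * a)) - 1 = t⁻¹ * (t' * (σ a * a) - t) := by field_simp
      rw [h, Valuation.map_mul, map_inv₀]
      have htv : Valued.v t ≠ 0 := (Valuation.ne_zero_iff _).2 ht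
      calc (Valued.v t)⁻¹ * Valued.v (t' * (σ a * a) - t) < (Valued.v t)⁻¹ * Valued.v t := by
            exact mul_lt_mul_of_pos_left hx (inv_pos.2 (zero_lt_iff.2 htv))
        _ = 1 := inv_mul_cancel₀ htv
    obtain ⟨z, hz, hzn⟩ := exists_eq_mul_map_of_map_eq_self_of_v_sub_one_lt_one σ hvσ h2 hσa' hlt
    -- `t' = z′·σz′·t` with `z′ = z ∕ a`
    have hσa0 : σ a ≠ 0 := (map_ne_zero σ).2 ha0
    have htt' : t' = (z * a⁻¹) * σ (z * a⁻¹) * t := by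
      rw [map_mul, map_inv₀]
      field_simp
      have h := hzn
      field_simp at h
      linear_combination h
    obtain ⟨k₃, hk₃, hk₃u⟩ := (exists_conj_eq_iff_exists_norm_mul σ hσ ht hu hu').2 ⟨z * a⁻¹, mul_ne_zero hz (inv_ne_zero ha0), htt'⟩
    refine ⟨k₂⁻¹ * k₃ * k₀, mul_mem (mul_mem (inv_mem hk₂) hk₃) hk₀, ?_⟩
    calc k₂⁻¹ * k₃ * k₀ * g₀ * (k₂⁻¹ * k₃ * k₀)⁻¹ = k₂⁻¹ * (k₃ * (k₀ * g₀ * k₀⁻¹) * k₃⁻¹) * k₂ := by group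
      _ = k₂⁻¹ * (k₂ * g * k₂⁻¹) * k₂ := by rw [hk₃u]
      _ = g := by group

/-- `{g ∈ GL₃(K) | (g − 1)^k = 0}` is closed (`K` Hausdorff). [cite: PlatonovRapinchuk1994, §3.1] -/
theorem isClosed_setOf_coe_sub_one_pow_eq_zero (k : ℕ) :
    IsClosed {g : GL (Fin 3) K | ((g : Matrix (Fin 3) (Fin 3) K) - 1) ^ k = 0} :=
  isClosed_eq ((Units.continuous_val.sub continuous_const).pow k) continuous_const

end MatrixSide

end Literature.NumberTheory.Automorphic.UnitaryGroup

end
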